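import Summits.QuantumFields.YangMills.Theorems.BalabanUVNodesN11NoExpansionDiagonalCoPR
import Literature.MathematicalPhysics.QuantumFieldTheory.Balaban1983to89.B16RLeafRecord13LiveClauseW

/-!
# DAG node N11 — THE s2∕s3 JUNCTION ON THE NO-EXPANSION DIAGONAL AT THE v1.6 `CoPR` RECORD, AT THE CURED RESIDUAL: dag-n11-d's 𝐓-side clauses WITH THE PINS
# DISCHARGED (`…BalabanUVNodesN11NoExpansionDiagonalCoPR`, [III] (3.24)–(3.25) at `θ.Zr p = ZrOfRecord₁₃ θ.toStage13Params p`, node00-def-K0a FILE 17) + this seat's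
# edition-free clause-level 𝐑-transfer (`…B16RLeafRecord13LiveClauseW`, [IV] (0.3)) ⇒ THE §2 CLAUSE OF THE POST-𝐑 SLOT at the all-large-field sequence; AT LEVEL ONE
# the start `SLaw₁₃CoPR θ p 0` is def-T's `sLaw₁₃CoPR_zero`, so the post-𝐑 slot of `ρ₁` at the large-field diagonal HAS THE §2 DICHOTOMY at every cured live-selector
# parameter with the provisos rows — and at EVERY CURED EXTENSION OF THE WITNESS OF RECORD from `0 < K` and the joint measurability of `w₀(s′)` alone

Cell `pub-ymgap`, YM-PLAN Track A (HUMAN RULING D-0062), seat `pub-ymgap-dag-n11-e` (g9; R134 fan-out row N11∕s3 «`ThmP245Printed` via `rOperation` from N13's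
`ROpLeaf` (pairs with n13-c)»), route `BalabanUVNodes` rev 22, item K1⁶ `StabilityBAtRecordR13SepCoPR` = stmt-QuantumFields-20507 (helper, count-neutral; dag-lead
WORDS-142).  [III] = [Balaban1988Convergent], [IV] = [Balaban1989LargeFieldI].  The v1.6 companion of this seat's `…BalabanUVNodesN11DiagonalLevelOneCoP` (p530429,
v1.5 `CoP`, pin DISPLAYED): under director-ym LINE №169∕№174 (FINDING №8, run-indexed residual slot `θ.Zr p`) the generation-wise pins are properties of K0a's
`ZrOfRecord₁₃` BY CONSTRUCTION, and dag-n11-d's `…NoExpansionDiagonalCoPR` (INTENT-7b) states the 𝐓-side clauses at `θ.Zr p = ZrOfRecord₁₃ θ.toStage13Params p` with the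
pins discharged.  The 𝐑-side import is this seat's W∕U-generic `…LiveClauseW` (p529096), read at `θ.toStage13Params` with `W := WtOfRecord₁₃R θ p` — the live-line
𝐑-chain never reads the 𝐓-weights.

WHAT THIS FILE PROVES (0 `sorry`, 0 `def`, standard axioms; `θ : Stage13RParams`, run `p`).
§1 at any cured `θ` carrying node00-def-T's live-selector clause: `slotClause_one_allLarge_CoPR_of_Zr_eq_ZrOfRecord_of_liveSel_of_rstep` — THE LEVEL-ONE POST-𝐑 CLAUSE
   «`slot₁(s′) = 0 ∨ slot₁(s′) = 𝐓₁(s′)e^{A₁(s′)}` a.e. on `supp χ₁(s′)`» at the all-large-field sequence of length 1, weights `WtOfRecord₁₃R θ p`, constant `E₁(s′) = E(p)`,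
   EVERY term-value witness, from row `rstep`, unity of def-T's `ζ`, the joint measurability of `w₀(s′)`, `0 < K`, `1 ≤ M` (dag-n11-d's identity branch + ClauseW's
   `slotClause_succ_of_slotTClause_of_liveSel_of_rstep`); ★★ `slotClause_one_allLarge_CoPR_of_provisos_of_liveSel` — the same from `h : θ.Provisos₁₃CoPR F N` ALONE
   (rows `rstep`, `zetaUnity`, `measω` through `.tstep … .measW`); `slotClause_succ_allLarge_CoPR_of_provisos_of_liveSel` — level `k+1` along the all-large-field history
   from `SLaw₁₃CoPR θ p k` and the displayed measurability ∕ bound of the old branch (dag-n11-d's `hasSect2FormAtZ_clause_succ_CoPR_of_provisos`).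
§2 ★★★ AT EVERY CURED EXTENSION OF THE WITNESS OF RECORD `(⟨theta13LiveOfRecord F N, Zr⟩ : Stage13RParams F N)` with `Zr p = ZrOfRecord₁₃ (theta13LiveOfRecord F N) p`
   (K0a's `Stage13RParams.ofCured (theta13LiveOfRecord F N)` by `rfl`): `slotClause_one_allLarge_theta13LiveOfRecord_cured` — the level-one post-𝐑 clause from `0 < K`
   and the joint measurability of `w₀(s′)` ONLY (row `rstep`, the selector clause, unity and `M = 1` are theorems at the witness of record).  THE FIRST INSTANCE OF
   THEOREM 1's STEP «ρ₀ ⇒ 𝐓ρ₀ ⇒ ρ₁» ([III] p. 262) CLOSED IN KERNEL AT A SEQUENCE OF A v1.6 WITNESS — both arrows by name, no pin hypothesis left.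
§3 at node00-def-K0a's cured family `Stage13RParams.ofCured θ₀` from the v1.5 CORE PROVISOS of `θ₀` (the K0⁶ witness shape; dag-n11-d's 7b §3):
   ★★ `slotClause_one_allLarge_ofCured_of_provisosCore_of_liveSel` (+ selector clause, `0 < K`, `1 ≤ M`) and ★★★ `slotClause_one_allLarge_ofCured_theta13LiveOfRecord_of_provisosCore`
   (at the cured witness of record: `Provisos₁₃Core` there + `0 < K` only).

HONEST FRAMING.  Count-neutral kernel bookkeeping; compositions of two seats' tree theorems; the ONE new sequence per level that carries no small-field expansion
— every other new sequence of level 1 is [III] Sect. 1 ∕ §3 proper (the load-bearing content of (S1ᵀ), NOT here); the joint measurability of `w₀(s′)` stays DISPLAYED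
at the witness (it is row `measω` under (H-U)); nothing of Bałaban asserted; N11 NOT discharged; K1⁶ NOT closed; counts unmoved (typed 28∕28 · discharged 5∕28).
One finite `𝕋⁴_{L^K}` programme at fixed `ε = L^{−K}`; NOT continuum ∕ OS ∕ mass-gap ∕ Clay.
-/

noncomputable section

open MeasureTheory
open scoped BigOperators Matrix.Norms.L2Operator

namespace Summit.QuantumFields.YangMills.Theorems.BalabanUVNodesN11DiagonalLevelOneCoPR

open Literature.MathematicalPhysics.QuantumFieldTheory.Balaban1983to89 T4Continuum Node00 Node00.Tk DagBinding
open Literature.MathematicalPhysics.QuantumFieldTheory.Balaban1983to89.B16RLeafRecord13LiveClauseW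
open Literature.MathematicalPhysics.QuantumFieldTheory.Balaban1983to89.B16RLeafRecord13LiveRstep (rstep₁₃_of_liveSel_of_hasResiduals)
open Literature.MathematicalPhysics.QuantumFieldTheory.Balaban1983to89.B16RLeafRecord13AtLive (liveRepin₁₃_liveSel)
open BalabanUVNodesN11NoExpansionDiagonalCoPR (hasSect2FormAtZ_clause_one_CoPR_of_Zr_eq_ZrOfRecord hasSect2FormAtZ_clause_one_CoPR_of_provisos
  hasSect2FormAtZ_clause_succ_CoPR_of_provisos hasSect2FormAtZ_clause_one_ofCured_of_provisosCore)

variable {F : T4Family} {N : ℕ} [NeZero N]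

/-! ## §1. At a cured `θ : Stage13RParams` carrying the live-selector clause -/

section Cured

variable (θ : Stage13RParams F N) (p : B12.RunParams)

/-- **THE LEVEL-ONE POST-𝐑 CLAUSE OF THE LARGE-FIELD DIAGONAL AT THE CURED RESIDUAL, live selector, row `rstep`**: at a v1.6 parameter with
`θ.Zr p = ZrOfRecord₁₃ θ.toStage13Params p` carrying node00-def-T's selector clause, for the new sequence `s′` of length 1 with `Ω₁(s′) = ∅` and EVERY term-value witness
`t`: «`slot₁(s′) = 0 ∨ slot₁(s′) = 𝐓₁(s′)e^{A₁(s′)}` `dV₁`-a.e. on `supp χ₁(s′)`» at the run's weights `WtOfRecord₁₃R θ p`, constant `E₁(s′) = E(p)`, def-R's support-edition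
background — dag-n11-d's identity branch for `slotT₁(s′)` (pins discharged by K0a's faces) followed by this seat's 𝐑-side clause transfer (a dead `s′` is absent from `ρ₁`,
a live `s′` is a fixed point of the selector where `slot = slotT` a.e. on the support). [cite: Balaban1988Convergent, Thm 1 p.262, Theorem p.245, (3.25) p.270, (1.11) p.248, (3.16)–(3.20) pp.268–269; Balaban1989LargeFieldI, (0.3) p.176, p.177 (i)–(ii)] -/
theorem slotClause_one_allLarge_CoPR_of_Zr_eq_ZrOfRecord_of_liveSel_of_rstep (hZr : θ.Zr p = ZrOfRecord₁₃ F N θ.toStage13Params p)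
    (hrstep : ∀ (p : B12.RunParams) (k : ℕ) [DecidableEq (PBond (F.P p.K) (k + 1))], k < p.K →
      (towerRepOfRecord F N θ.ν θ.τ9 (slotsTOfRecord F N θ.ν θ.τ9 (EOfRecord₁₃ F N θ.toStage13Params) (wOfRecord₉ F N θ.toStage9Params) θ.ppSel)
        θ.ppSel p (gOfRecord₁₃ F N θ.toStage13Params p) (k + 1)).toRepData.ProvisosInt)
    (hsel : θ.ppSel = ppSelLiveOfRecord F N θ.ν θ.τ9 (EOfRecord₁₃ F N θ.toStage13Params) (wOfRecord₉ F N θ.toStage9Params))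
    (hK : 0 < p.K) (hM : 1 ≤ θ.τ9.M) (hζu : IsZetaUnity F N θ.ν θ.τ9.M θ.ζ)
    (s : SeqOfRecord F θ.ν θ.τ9.M (gOfRecord₁₃ F N θ.toStage13Params p) p.K 1) (hΩ : s.Ω 1 = ∅)
    (hmw : Measurable fun z : GaugeField (F.P p.K) 1 (SU N) × GaugeField (F.P p.K) 0 (SU N) =>
      wOfRecord₉ F N θ.toStage9Params p (gOfRecord₁₃ F N θ.toStage13Params p) 0 s z.2 z.1)
    (t : Sect2.TermValues (F.P p.K) (MatA N) (FluctV N) θ.τ9.M) :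
    slotsOfRecord F N θ.ν θ.τ9 (EOfRecord₁₃ F N θ.toStage13Params) (wOfRecord₉ F N θ.toStage9Params) θ.ppSel p
        (gOfRecord₁₃ F N θ.toStage13Params p) 1 s = 0 ∨
      ∀ᵐ V1 ∂fieldMeasure (F.P p.K) 1 (SU N),
        chiSeqOfRecord F N θ.ν θ.τ9.M (gOfRecord₁₃ F N θ.toStage13Params p) p.K 1 s V1 ≠ 0 →
          slotsOfRecord F N θ.ν θ.τ9 (EOfRecord₁₃ F N θ.toStage13Params) (wOfRecord₉ F N θ.toStage9Params) θ.ppSel p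
              (gOfRecord₁₃ F N θ.toStage13Params p) 1 s V1 =
            sect2Slot F N (FluctV N) p.K (settingOfRecord₁₃ F N θ.toStage13Params p) (θ.Rz p.K) (WtOfRecord₁₃R F N θ p) s t
              (EOfRecord₁₃ F N θ.toStage13Params p) (UbgOfRecord₁₃CoP F N θ.toStage13Params p 1 s) V1 :=
  slotClause_succ_of_slotTClause_of_liveSel_of_rstep F N θ.toStage13Params p hrstep hsel 0 hK (WtOfRecord₁₃R F N θ p) s t
    (EOfRecord₁₃ F N θ.toStage13Params p) (UbgOfRecord₁₃CoP F N θ.toStage13Params p 1 s)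
    fun _ => hasSect2FormAtZ_clause_one_CoPR_of_Zr_eq_ZrOfRecord θ p hZr hK hM hζu s hΩ hmw t

/-- **★★ THE LEVEL-ONE POST-𝐑 CLAUSE AT THE CURED RESIDUAL FROM THE PROVISOS ROWS ALONE** (+ the live-selector clause, `0 < K`, `1 ≤ M`): row `rstep` feeds the 𝐑-side,
rows `zetaUnity` ∕ `measω` (through `Provisos₁₃CoPR.tstep … .measW`) feed dag-n11-d's 𝐓-side (`hasSect2FormAtZ_clause_one_CoPR_of_provisos`).  With the start
`SLaw₁₃CoPR θ p 0` (def-T's `sLaw₁₃CoPR_zero`: `ρ₀` has no terms) this is THE LEVEL-ONE INSTANCE OF THEOREM 1's STEP at the large-field diagonal of a cured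
record. [cite: Balaban1988Convergent, Thm 1 p.262, Theorem p.245, (3.25) p.270, (3.2)–(3.5) pp.264–265, (1.11) p.248; Balaban1989LargeFieldI, (0.3) p.176, p.177 (i)–(ii)] -/
theorem slotClause_one_allLarge_CoPR_of_provisos_of_liveSel (hZr : θ.Zr p = ZrOfRecord₁₃ F N θ.toStage13Params p) (h : θ.Provisos₁₃CoPR F N)
    (hsel : θ.ppSel = ppSelLiveOfRecord F N θ.ν θ.τ9 (EOfRecord₁₃ F N θ.toStage13Params) (wOfRecord₉ F N θ.toStage9Params))
    (hK : 0 < p.K) (hM : 1 ≤ θ.τ9.M)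
    (s : SeqOfRecord F θ.ν θ.τ9.M (gOfRecord₁₃ F N θ.toStage13Params p) p.K 1) (hΩ : s.Ω 1 = ∅)
    (t : Sect2.TermValues (F.P p.K) (MatA N) (FluctV N) θ.τ9.M) :
    slotsOfRecord F N θ.ν θ.τ9 (EOfRecord₁₃ F N θ.toStage13Params) (wOfRecord₉ F N θ.toStage9Params) θ.ppSel p
        (gOfRecord₁₃ F N θ.toStage13Params p) 1 s = 0 ∨
      ∀ᵐ V1 ∂fieldMeasure (F.P p.K) 1 (SU N),
        chiSeqOfRecord F N θ.ν θ.τ9.M (gOfRecord₁₃ F N θ.toStage13Params p) p.K 1 s V1 ≠ 0 →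
          slotsOfRecord F N θ.ν θ.τ9 (EOfRecord₁₃ F N θ.toStage13Params) (wOfRecord₉ F N θ.toStage9Params) θ.ppSel p
              (gOfRecord₁₃ F N θ.toStage13Params p) 1 s V1 =
            sect2Slot F N (FluctV N) p.K (settingOfRecord₁₃ F N θ.toStage13Params p) (θ.Rz p.K) (WtOfRecord₁₃R F N θ p) s t
              (EOfRecord₁₃ F N θ.toStage13Params p) (UbgOfRecord₁₃CoP F N θ.toStage13Params p 1 s) V1 :=
  slotClause_succ_of_slotTClause_of_liveSel_of_rstep F N θ.toStage13Params p (fun p k _ hk => h.rstep p k hk) hsel 0 hK (WtOfRecord₁₃R F N θ p) s t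
    (EOfRecord₁₃ F N θ.toStage13Params p) (UbgOfRecord₁₃CoP F N θ.toStage13Params p 1 s)
    fun _ => hasSect2FormAtZ_clause_one_CoPR_of_provisos θ p hZr h hK hM s hΩ t

/-- **LEVEL `k+1` ALONG THE ALL-LARGE-FIELD HISTORY AT THE CURED RESIDUAL — the post-𝐑 clause** from `SLaw₁₃CoPR θ p k`, the provisos rows, the live-selector clause and
the displayed measurability ∕ bound of the old branch `U ↦ 𝐓_k(init s′,∅)e^{A_k(init s′)}(U)` (pins discharged: dag-n11-d's `hasSect2FormAtZ_clause_succ_CoPR_of_provisos`),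
EVERY term-value witness, constant `E_{k+1}(s′) = E_k(init s′)`. [cite: Balaban1988Convergent, Theorem p.245, Thm 1 p.262, (3.24)–(3.25) p.270, (1.11) p.248; Balaban1989LargeFieldI, (0.3) p.176, p.177 (i)–(ii)] -/
theorem slotClause_succ_allLarge_CoPR_of_provisos_of_liveSel (hZr : θ.Zr p = ZrOfRecord₁₃ F N θ.toStage13Params p) (h : θ.Provisos₁₃CoPR F N)
    (hsel : θ.ppSel = ppSelLiveOfRecord F N θ.ν θ.τ9 (EOfRecord₁₃ F N θ.toStage13Params) (wOfRecord₉ F N θ.toStage9Params))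
    {k : ℕ} (hk : k < p.K) (hM : 1 ≤ θ.τ9.M) (hS : SLaw₁₃CoPR F N θ p k)
    (s : SeqOfRecord F θ.ν θ.τ9.M (gOfRecord₁₃ F N θ.toStage13Params p) p.K (k + 1)) (hall : ∀ j, 1 ≤ j → j ≤ k + 1 → s.Ω j = ∅)
    {C : ℝ}
    (hmB : ∀ (t : Sect2.TermValues (F.P p.K) (MatA N) (FluctV N) θ.τ9.M) (Ek : ℝ),
      Measurable fun U₀ : GaugeField (F.P p.K) k (SU N) =>
        tkBranchOfRecord F N (FluctV N) θ.ν θ.τ9.M _ p.K (WtOfRecord₁₃R F N θ p) s.init (fun _ => ∅) k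
          (fun ω => sect2Operand F N (FluctV N) p.K (settingOfRecord₁₃ F N θ.toStage13Params p) (θ.Rz p.K) s.init t Ek
            (UbgOfRecord₁₃CoP F N θ.toStage13Params p k s.init) ((fun _ => ∅ : ℕ → Set (Site (F.P p.K) 0)), fun j => (ω j).2) (fun j => (ω j).1))
          (baseCfg (V := FluctV N) k U₀))
    (hCB : ∀ (t : Sect2.TermValues (F.P p.K) (MatA N) (FluctV N) θ.τ9.M) (Ek : ℝ) (U₀ : GaugeField (F.P p.K) k (SU N)),
      |tkBranchOfRecord F N (FluctV N) θ.ν θ.τ9.M _ p.K (WtOfRecord₁₃R F N θ p) s.init (fun _ => ∅) k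
          (fun ω => sect2Operand F N (FluctV N) p.K (settingOfRecord₁₃ F N θ.toStage13Params p) (θ.Rz p.K) s.init t Ek
            (UbgOfRecord₁₃CoP F N θ.toStage13Params p k s.init) ((fun _ => ∅ : ℕ → Set (Site (F.P p.K) 0)), fun j => (ω j).2) (fun j => (ω j).1))
          (baseCfg (V := FluctV N) k U₀)| ≤ C)
    (t' : Sect2.TermValues (F.P p.K) (MatA N) (FluctV N) θ.τ9.M) :
    ∃ Ek' : ℝ,
      slotsOfRecord F N θ.ν θ.τ9 (EOfRecord₁₃ F N θ.toStage13Params) (wOfRecord₉ F N θ.toStage9Params) θ.ppSel p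
          (gOfRecord₁₃ F N θ.toStage13Params p) (k + 1) s = 0 ∨
        ∀ᵐ V' ∂fieldMeasure (F.P p.K) (k + 1) (SU N),
          chiSeqOfRecord F N θ.ν θ.τ9.M (gOfRecord₁₃ F N θ.toStage13Params p) p.K (k + 1) s V' ≠ 0 →
            slotsOfRecord F N θ.ν θ.τ9 (EOfRecord₁₃ F N θ.toStage13Params) (wOfRecord₉ F N θ.toStage9Params) θ.ppSel p
                (gOfRecord₁₃ F N θ.toStage13Params p) (k + 1) s V' =
              sect2Slot F N (FluctV N) p.K (settingOfRecord₁₃ F N θ.toStage13Params p) (θ.Rz p.K) (WtOfRecord₁₃R F N θ p) s t' Ek'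
                (UbgOfRecord₁₃CoP F N θ.toStage13Params p (k + 1) s) V' := by
  obtain ⟨Ek', hT⟩ := hasSect2FormAtZ_clause_succ_CoPR_of_provisos θ p hZr h hk hM hS s hall hmB hCB t'
  exact ⟨Ek', slotClause_succ_of_slotTClause_of_liveSel_of_rstep F N θ.toStage13Params p (fun p k _ hk => h.rstep p k hk) hsel k hk
    (WtOfRecord₁₃R F N θ p) s t' Ek' (UbgOfRecord₁₃CoP F N θ.toStage13Params p (k + 1) s) fun _ => hT⟩

end Cured

/-! ## §2. AT EVERY CURED EXTENSION OF THE WITNESS OF RECORD -/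

section OfRecord

variable (F N)
variable (Zr : (q : B12.RunParams) → TkResidualW F N (FluctV N) q.K) (p : B12.RunParams)

/-- **★★★ THE LEVEL-ONE POST-𝐑 §2 CLAUSE OF THE LARGE-FIELD DIAGONAL AT EVERY CURED EXTENSION OF THE WITNESS OF RECORD** — `(⟨theta13LiveOfRecord F N, Zr⟩ :
Stage13RParams F N)` with `Zr p = ZrOfRecord₁₃ (theta13LiveOfRecord F N) p` (node00-def-K0a's `Stage13RParams.ofCured (theta13LiveOfRecord F N)` by `rfl`): for the new
sequence `s′` of length 1 with `Ω₁(s′) = ∅` and EVERY term-value witness `t`, «`slot₁(s′) = 0 ∨ slot₁(s′) = 𝐓₁(s′)e^{A₁(s′)}` `dV₁`-a.e. on `supp χ₁(s′)`» at the run's v1.6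
weights and def-R's support-edition background, constant `E₁(s′) = E(p)` — from `0 < K` and the joint measurability of `w₀(s′)` ONLY: row `rstep` and the selector clause
are K0a∕K0b∕def-R theorems at the witness of record (`rstep₁₃_of_liveSel_of_hasResiduals`, `liveRepin₁₃_liveSel`), unity of def-T's `ζ` is P4 `isZetaUnity_zeta316OfRecord`
at K0b's residual (`HasResidualsOfRecord.zeta_eq`), `M = 1` by the family's numerals.  Theorem 1's first step «ρ₀ ⇒ 𝐓ρ₀ ⇒ ρ₁» ([III] p. 262) CLOSED IN KERNEL at a
sequence of a v1.6 witness, both arrows by name (dag-n11-d 𝐓-side, this seat 𝐑-side), no pin hypothesis. [cite: Balaban1988Convergent, Thm 1 p.262, Theorem p.245, (3.25) p.270, (1.11) p.248, (3.16)–(3.22) pp.268–269; Balaban1989LargeFieldI, (0.3)–(0.4) p.176, p.177 (i)–(ii)] -/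
theorem slotClause_one_allLarge_theta13LiveOfRecord_cured (hZr : Zr p = ZrOfRecord₁₃ F N (theta13LiveOfRecord F N) p) (hK : 0 < p.K)
    (s : SeqOfRecord F (theta13LiveOfRecord F N).ν (theta13LiveOfRecord F N).τ9.M (gOfRecord₁₃ F N (theta13LiveOfRecord F N) p) p.K 1) (hΩ : s.Ω 1 = ∅)
    (hmw : Measurable fun z : GaugeField (F.P p.K) 1 (SU N) × GaugeField (F.P p.K) 0 (SU N) =>
      wOfRecord₉ F N (theta13LiveOfRecord F N).toStage9Params p (gOfRecord₁₃ F N (theta13LiveOfRecord F N) p) 0 s z.2 z.1)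
    (t : Sect2.TermValues (F.P p.K) (MatA N) (FluctV N) (theta13LiveOfRecord F N).τ9.M) :
    slotsOfRecord F N (theta13LiveOfRecord F N).ν (theta13LiveOfRecord F N).τ9 (EOfRecord₁₃ F N (theta13LiveOfRecord F N))
        (wOfRecord₉ F N (theta13LiveOfRecord F N).toStage9Params) (theta13LiveOfRecord F N).ppSel p (gOfRecord₁₃ F N (theta13LiveOfRecord F N) p) 1 s = 0 ∨
      ∀ᵐ V1 ∂fieldMeasure (F.P p.K) 1 (SU N),
        chiSeqOfRecord F N (theta13LiveOfRecord F N).ν (theta13LiveOfRecord F N).τ9.M (gOfRecord₁₃ F N (theta13LiveOfRecord F N) p) p.K 1 s V1 ≠ 0 →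
          slotsOfRecord F N (theta13LiveOfRecord F N).ν (theta13LiveOfRecord F N).τ9 (EOfRecord₁₃ F N (theta13LiveOfRecord F N))
              (wOfRecord₉ F N (theta13LiveOfRecord F N).toStage9Params) (theta13LiveOfRecord F N).ppSel p (gOfRecord₁₃ F N (theta13LiveOfRecord F N) p) 1 s V1 =
            sect2Slot F N (FluctV N) p.K (settingOfRecord₁₃ F N (theta13LiveOfRecord F N) p) ((theta13LiveOfRecord F N).Rz p.K)
              (WtOfRecord₁₃R F N (⟨theta13LiveOfRecord F N, Zr⟩ : Stage13RParams F N) p) s t (EOfRecord₁₃ F N (theta13LiveOfRecord F N) p)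
              (UbgOfRecord₁₃CoP F N (theta13LiveOfRecord F N) p 1 s) V1 := by
  -- unity of def-T's `ζ` at K0b's residual, and `M = 1` by the family's numerals
  have hζu : IsZetaUnity F N (theta13LiveOfRecord F N).ν (theta13LiveOfRecord F N).τ9.M (theta13LiveOfRecord F N).ζ := by
    rw [(hasResidualsOfRecord_theta13LiveOfRecord F N).zeta_eq]
    exact isZetaUnity_zeta316OfRecord _
  have hM : 1 ≤ (theta13LiveOfRecord F N).τ9.M := le_of_eq rfl
  -- the 𝐓-side clause at the extension `⟨θ_rec, Zr⟩` (its `.toStage13Params` is `θ_rec` and its `.Zr` is `Zr`, both by `rfl`), stated EXPLICITLY at the extension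
  have hT := hasSect2FormAtZ_clause_one_CoPR_of_Zr_eq_ZrOfRecord (⟨theta13LiveOfRecord F N, Zr⟩ : Stage13RParams F N) p hZr hK hM hζu s hΩ hmw t
  exact slotClause_succ_of_slotTClause_theta13LiveOfRecord F N p 0 hK (WtOfRecord₁₃R F N (⟨theta13LiveOfRecord F N, Zr⟩ : Stage13RParams F N) p) s t
    (EOfRecord₁₃ F N (theta13LiveOfRecord F N) p) (UbgOfRecord₁₃CoP F N (theta13LiveOfRecord F N) p 1 s) fun _ => hT

end OfRecord

/-! ## §3. AT node00-def-K0a's CURED FAMILY `Stage13RParams.ofCured θ₀` FROM THE v1.5 CORE PROVISOS OF `θ₀` (the K0⁶ witness shape) -/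

section OfCured

variable (θ₀ : Stage13Params F N) (p : B12.RunParams)

/-- **★★ THE LEVEL-ONE POST-𝐑 CLAUSE AT THE CURED FAMILY `ofCured θ₀` FROM `θ₀.Provisos₁₃Core` ALONE** (+ node00-def-T's live-selector clause of `θ₀`, `0 < K`, `1 ≤ M`):
dag-n11-d's `hasSect2FormAtZ_clause_one_ofCured_of_provisosCore` (pins discharged by K0a's `ZrOfRecord₁₃`; unity ∕ measurability from the core rows) followed by this seat's
clause transfer at `θ₀` from row `rstep` — the K1⁶ knit's K0-shaped hypothesis (`Provisos₁₃Core` of the presenting parameter) is all the level-one large-field-diagonal step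
of Theorem 1 needs on the live line. [cite: Balaban1988Convergent, Thm 1 p.262, Theorem p.245, (3.25) p.270, (3.2)–(3.5) pp.264–265, (1.11) p.248; Balaban1989LargeFieldI, (0.3) p.176, p.177 (i)–(ii)] -/
theorem slotClause_one_allLarge_ofCured_of_provisosCore_of_liveSel (h : θ₀.Provisos₁₃Core F N)
    (hsel : θ₀.ppSel = ppSelLiveOfRecord F N θ₀.ν θ₀.τ9 (EOfRecord₁₃ F N θ₀) (wOfRecord₉ F N θ₀.toStage9Params)) (hK : 0 < p.K) (hM : 1 ≤ θ₀.τ9.M)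
    (s : SeqOfRecord F θ₀.ν θ₀.τ9.M (gOfRecord₁₃ F N θ₀ p) p.K 1) (hΩ : s.Ω 1 = ∅) (t : Sect2.TermValues (F.P p.K) (MatA N) (FluctV N) θ₀.τ9.M) :
    slotsOfRecord F N θ₀.ν θ₀.τ9 (EOfRecord₁₃ F N θ₀) (wOfRecord₉ F N θ₀.toStage9Params) θ₀.ppSel p (gOfRecord₁₃ F N θ₀ p) 1 s = 0 ∨
      ∀ᵐ V1 ∂fieldMeasure (F.P p.K) 1 (SU N),
        chiSeqOfRecord F N θ₀.ν θ₀.τ9.M (gOfRecord₁₃ F N θ₀ p) p.K 1 s V1 ≠ 0 →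
          slotsOfRecord F N θ₀.ν θ₀.τ9 (EOfRecord₁₃ F N θ₀) (wOfRecord₉ F N θ₀.toStage9Params) θ₀.ppSel p (gOfRecord₁₃ F N θ₀ p) 1 s V1 =
            sect2Slot F N (FluctV N) p.K (settingOfRecord₁₃ F N θ₀ p) (θ₀.Rz p.K) (WtOfRecord₁₃R F N (Stage13RParams.ofCured F N θ₀) p) s t
              (EOfRecord₁₃ F N θ₀ p) (UbgOfRecord₁₃CoP F N θ₀ p 1 s) V1 :=
  slotClause_succ_of_slotTClause_of_liveSel_of_rstep F N θ₀ p (fun p k _ hk => h.rstep p k hk) hsel 0 hK (WtOfRecord₁₃R F N (Stage13RParams.ofCured F N θ₀) p) s t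
    (EOfRecord₁₃ F N θ₀ p) (UbgOfRecord₁₃CoP F N θ₀ p 1 s)
    fun _ => hasSect2FormAtZ_clause_one_ofCured_of_provisosCore θ₀ p h hK hM s hΩ t

end OfCured

section OfCuredRecord

variable (F N)
variable (p : B12.RunParams)

/-- **★★★ … AT K0a's CURED WITNESS OF RECORD `Stage13RParams.ofCured (theta13LiveOfRecord F N)` FROM `Provisos₁₃Core` AT THE WITNESS AND `0 < K`** (the selector clause,
row `rstep`'s use and `M = 1` are theorems there): the level-one post-𝐑 §2 clause of the large-field diagonal — Theorem 1's first step at a v1.6 witness of record, the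
K0⁶ conjunct `Provisos₁₃Core` as the only displayed input. [cite: Balaban1988Convergent, Thm 1 p.262, Theorem p.245, (3.25) p.270, (1.11) p.248, (3.16)–(3.22) pp.268–269; Balaban1989LargeFieldI, (0.3)–(0.4) p.176, p.177 (i)–(ii)] -/
theorem slotClause_one_allLarge_ofCured_theta13LiveOfRecord_of_provisosCore (h : (theta13LiveOfRecord F N).Provisos₁₃Core F N) (hK : 0 < p.K)
    (s : SeqOfRecord F (theta13LiveOfRecord F N).ν (theta13LiveOfRecord F N).τ9.M (gOfRecord₁₃ F N (theta13LiveOfRecord F N) p) p.K 1) (hΩ : s.Ω 1 = ∅)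
    (t : Sect2.TermValues (F.P p.K) (MatA N) (FluctV N) (theta13LiveOfRecord F N).τ9.M) :
    slotsOfRecord F N (theta13LiveOfRecord F N).ν (theta13LiveOfRecord F N).τ9 (EOfRecord₁₃ F N (theta13LiveOfRecord F N))
        (wOfRecord₉ F N (theta13LiveOfRecord F N).toStage9Params) (theta13LiveOfRecord F N).ppSel p (gOfRecord₁₃ F N (theta13LiveOfRecord F N) p) 1 s = 0 ∨
      ∀ᵐ V1 ∂fieldMeasure (F.P p.K) 1 (SU N),
        chiSeqOfRecord F N (theta13LiveOfRecord F N).ν (theta13LiveOfRecord F N).τ9.M (gOfRecord₁₃ F N (theta13LiveOfRecord F N) p) p.K 1 s V1 ≠ 0 →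
          slotsOfRecord F N (theta13LiveOfRecord F N).ν (theta13LiveOfRecord F N).τ9 (EOfRecord₁₃ F N (theta13LiveOfRecord F N))
              (wOfRecord₉ F N (theta13LiveOfRecord F N).toStage9Params) (theta13LiveOfRecord F N).ppSel p (gOfRecord₁₃ F N (theta13LiveOfRecord F N) p) 1 s V1 =
            sect2Slot F N (FluctV N) p.K (settingOfRecord₁₃ F N (theta13LiveOfRecord F N) p) ((theta13LiveOfRecord F N).Rz p.K)
              (WtOfRecord₁₃R F N (Stage13RParams.ofCured F N (theta13LiveOfRecord F N)) p) s t (EOfRecord₁₃ F N (theta13LiveOfRecord F N) p)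
              (UbgOfRecord₁₃CoP F N (theta13LiveOfRecord F N) p 1 s) V1 :=
  slotClause_succ_of_slotTClause_theta13LiveOfRecord F N p 0 hK (WtOfRecord₁₃R F N (Stage13RParams.ofCured F N (theta13LiveOfRecord F N)) p) s t
    (EOfRecord₁₃ F N (theta13LiveOfRecord F N) p) (UbgOfRecord₁₃CoP F N (theta13LiveOfRecord F N) p 1 s)
    fun _ => hasSect2FormAtZ_clause_one_ofCured_of_provisosCore (theta13LiveOfRecord F N) p h hK (le_of_eq rfl) s hΩ t

end OfCuredRecord

end Summit.QuantumFields.YangMills.Theorems.BalabanUVNodesN11DiagonalLevelOneCoPR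

end
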